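import Summits.ResolutionOfSingularities.ResolutionOfSingularities.Theorems.WeightedInvariantOrbitCentreHomogeneous
import Summits.ResolutionOfSingularities.ResolutionOfSingularities.Theorems.WeightedInvariantHomogeneousMinimalPrimes
import Literature.AlgebraicGeometry.Resolution.MaximalPoints
import Summits.ResolutionOfSingularities.ResolutionOfSingularities.Theorems.WeightedInvariantHypersurfaceCentreChoiceToDatum
import HarnessLib

/-!
# (hom) for all chart gradings of the orbit centre — at a MAXIMAL point of the singular image: the prime of the
# point is homogeneous, and the (hom) clause of `IsAdmissibleCentre` for the contracted centre

Route `ResolutionOfSingularities/WeightedInvariant`, door crux `HypersurfaceCentreConstruction`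
(stmt-ResolutionOfSingularities-19897) — OURS, helper; e-ladder rung `e = 1`, registered stub `stub_e1_centre` of
`res-L1-w43-stub-10` (item (L3) of `D/res-D-pv-025/DOOR-ELADDER-PLAN.md` §7, res-type-047).  Glue over the closer
`OrbitCentreHomogeneous.isHomogeneous_germContractionIdeal_weightedMonomialIdeal` (p515852): its hypothesis «the prime
of `η` in `Γ(Y, W)` is homogeneous» is discharged at every MAXIMAL POINT `η` of the singular image `singImage X`
(`ELadderOne.Stage.maxSing`: `η ∈ singImage X ∧ ∀ y ∈ singImage X, η ∈ closure {y} → y = η`), and the clause `(hom)`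
of `IsAdmissibleCentre` is delivered for the orbit centre `ReesAlgebraData.ofGermFiltration η (x^α : w·α ≥ ·)`
(p507610) in exactly its binder shape:

* `isHomogeneous_primeIdealOf_of_maximal_singImage` — for every affine open `W ∋ η` and every `ℤʲ`-grading of
  `Γ(Y, W)` making `X(W)` homogeneous, the prime of a MAXIMAL point `η` of `singImage X` is homogeneous: it is a
  minimal prime over the reduced chart ideal of the non-regular locus (Literature
  `primeIdealOf_mem_minimalPrimes_of_mem_maxPoints`, `MaximalPoints.lean`), which is torus-stable, and minimal primes
  over homogeneous ideals are homogeneous (res-D-pv-025's `isHomogeneous_of_mem_minimalPrimes_vanishingIdeal_singSet`,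
  p501807) — the same two-line argument res-type-017 uses over the successor stage (`…ELadderOneOverMaxSing`);
* `isHomogeneous_ofGermFiltration_weightedMonomialIdeal_piece_ideal` — MODULO ⟨F-AQS-T⟩
  (`hAQS₂ : AbramovichQuekSchober2025_separableBaseChange` [cite: AbramovichQuekSchober2025]): for `Y → Spec k`
  locally of finite type, `η` a maximal point of `singImage X` with regular 2-dimensional local ring at which `X_η`
  is principal, non-zero, not a `(y^ν)`, and `(x; w; ℓ)` the lex-maximal admissible weighted centre germ of `X_η`,
  the Rees algebra `ofGermFiltration η (fun n ↦ weightedMonomialIdeal x w n)` satisfies the clause `(hom)` of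
  `IsAdmissibleCentre`: on EVERY affine open `W` with EVERY `ℤʲ`-grading making `X(W)` homogeneous, every piece is
  homogeneous (`η ∉ W`: the piece is the unit ideal).

No definitions.  Nothing here is a claim about Hironaka's problem or about any manuscript under adjudication;
AI-written, weaker than expert review.
-/

noncomputable section

set_option linter.dupNamespace false -- mandated namespace of this single-conjunct summit

namespace Summit.ResolutionOfSingularities.ResolutionOfSingularities.Theorems.OrbitCentreHomogeneous

open IsLocalRing CategoryTheory AlgebraicGeometry TopologicalSpace
open Literature.AlgebraicGeometry.Resolution Scheme.IdealSheafData

universe u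

/-! ## At a maximal point of the singular image the prime is homogeneous -/

/-- **The prime of a maximal point of `singImage X` is homogeneous** on every affine chart `W ∋ η` for every
`ℤʲ`-grading of `Γ(Y, W)` making `X(W)` homogeneous: it is a minimal prime over the (homogeneous) reduced ideal of the
non-regular locus (res-D-pv-025, p501807). [folklore] -/
theorem isHomogeneous_primeIdealOf_of_maximal_singImage {k : Type} [Field k] {Y : Scheme.{0}}
    (f : Y ⟶ Spec (.of k)) [LocallyOfFiniteType f] (X : Y.IdealSheafData) {η : Y} (hη : η ∈ singImage X)
    (hmax : ∀ y ∈ singImage X, η ∈ closure ({y} : Set Y) → y = η)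
    {j : ℕ} (W : Y.affineOpens) (hηW : η ∈ (W : Y.Opens)) (𝒜 : (Fin j → ℤ) → AddSubgroup Γ(Y, W))
    [GradedRing 𝒜] (hX : (X.ideal W).IsHomogeneous 𝒜) :
    ((W.2.primeIdealOf ⟨η, hηW⟩).asIdeal).IsHomogeneous 𝒜 := by
  let Z : Closeds Y := ⟨singImage X, isClosed_singSet f X⟩
  have hηmax : η ∈ maxPoints (singImage X) :=
    ⟨hη, fun z hz hzη => hmax z hz (specializes_iff_mem_closure.mp hzη)⟩
  have hmin : (W.2.primeIdealOf ⟨η, hηW⟩).asIdeal ∈ ((vanishingIdeal Z).ideal W).minimalPrimes := by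
    rw [Scheme.IdealSheafData.vanishingIdeal_ideal]
    exact primeIdealOf_mem_minimalPrimes_of_mem_maxPoints W.2 Z.2 hηmax hηW
  exact isHomogeneous_of_mem_minimalPrimes_vanishingIdeal_singSet f X Z rfl W 𝒜 hX hmin

/-! ## The (hom) clause of `IsAdmissibleCentre` for the orbit centre -/

/-- **(L3), delivered in the binder shape of `IsAdmissibleCentre`'s clause (hom).**  MODULO ⟨F-AQS-T⟩
(`hAQS₂ : AbramovichQuekSchober2025_separableBaseChange`): for `f : Y → Spec k` locally of finite type, `X` an ideal
sheaf, `η` a MAXIMAL point of `singImage X` whose local ring is regular of dimension `2`, at which `X_η` is principal,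
non-zero and not a `(y^ν)`, and `(x; w; ℓ)` the lex-maximal admissible weighted centre germ of `X_η`
(Abramovich–Quek–Schober), the orbit centre `ofGermFiltration η (fun n ↦ weightedMonomialIdeal x w n)` has
HOMOGENEOUS pieces on every affine open `W` for every `ℤʲ`-grading of `Γ(Y, W)` making `X(W)` homogeneous (the
degree-`0` condition on the constants is accepted and not used).  [cite: AbramovichQuekSchober2025, Thm 1.1 (1) via
Thm 3.5 / §5 (i)] -/
theorem isHomogeneous_ofGermFiltration_weightedMonomialIdeal_piece_ideal
    (hAQS₂ : AbramovichQuekSchober2025_separableBaseChange)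
    {k : Type} [Field k] {Y : Scheme.{0}} (f : Y ⟶ Spec (.of k)) [LocallyOfFiniteType f]
    (X : Y.IdealSheafData) (η : Y) (hη : η ∈ singImage X)
    (hmax : ∀ y ∈ singImage X, η ∈ closure ({y} : Set Y) → y = η)
    (hreg : IsRegularLocalRing (Y.presheaf.stalk η))
    (hdim : ringKrullDim (Y.presheaf.stalk η) = ((2 : ℕ) : WithBot ℕ∞))
    (hprinc : (stalkIdeal X η).IsPrincipal) (hne : stalkIdeal X η ≠ ⊥)
    (hnot : ∀ y ∈ maximalIdeal (Y.presheaf.stalk η), y ∉ maximalIdeal (Y.presheaf.stalk η) ^ 2 →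
      ∀ ν : ℕ, stalkIdeal X η ≠ Ideal.span {y ^ ν})
    (x : Fin 2 → Y.presheaf.stalk η) (w : Fin 2 → ℕ) (ℓ : ℕ)
    (hx : IsLexMaxWeightedCentreGerm (Y.presheaf.stalk η) (stalkIdeal X η) x w ℓ)
    (h0 : weightedMonomialIdeal x w 0 = ⊤)
    (hmul : ∀ m n, weightedMonomialIdeal x w m * weightedMonomialIdeal x w n ≤ weightedMonomialIdeal x w (m + n))
    (hprim : ∀ n, ∃ N : ℕ, maximalIdeal (Y.presheaf.stalk η) ^ N ≤ weightedMonomialIdeal x w n)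
    (j : ℕ) (W : Y.affineOpens) (𝒜 : (Fin j → ℤ) → AddSubgroup Γ(Y, W)) [GradedRing 𝒜]
    (_h𝒜 : ∀ c : Γ(Spec (.of k), ⊤), f.appLE ⊤ W le_top c ∈ 𝒜 0) (hX : (X.ideal W).IsHomogeneous 𝒜) (n : ℕ) :
    (((ReesAlgebraData.ofGermFiltration η (fun n => weightedMonomialIdeal x w n) h0 hmul hprim).piece n).ideal
      W).IsHomogeneous 𝒜 := by
  change (germContractionIdeal η (weightedMonomialIdeal x w n) W).IsHomogeneous 𝒜
  by_cases hηW : η ∈ (W : Y.Opens)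
  · exact isHomogeneous_germContractionIdeal_weightedMonomialIdeal hAQS₂ f X η hreg hdim hprinc hne hnot x w ℓ hx W
      hηW 𝒜 hX (isHomogeneous_primeIdealOf_of_maximal_singImage f X hη hmax W hηW 𝒜 hX) n
  · rw [germContractionIdeal_of_not_mem η _ hηW]
    exact Ideal.IsHomogeneous.top 𝒜

end Summit.ResolutionOfSingularities.ResolutionOfSingularities.Theorems.OrbitCentreHomogeneous

end
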